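/- Fleet lead `ym-wcr-19456-p1`, route `WeakCouplingRates`, crux `ColdBoxTwoPointFloorW` (stmt-QuantumFields-19608). -/
import Mathlib.MeasureTheory.Integral.Pi
import Mathlib.MeasureTheory.Integral.Bochner.Basic
import HarnessLib

/-!
# Crux `ColdBoxTwoPointFloor(W)`, piece S3c-ii step 6: the connected two-point function of COLOUR SUMS under a product measure is
# the sum over the colours — `Cov_{μ^{⊗ι}}(Σ_c f(x_c), Σ_c g(x_c)) = |ι| · Cov_μ(f, g)`

The `SU(2)` plaquette cost in the chart is, to leading order, `½ Σ_{c=1}^{3} t^c(p)²` with the three colour components `t^c`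
independent copies of the Dirichlet Gaussian field D1' (`boxDirichlet H`); this file supplies the probability step that turns the
ONE-component Wick identity `boxDirCircSqCov = 2Π_D²` (`…ColdBoxDirichletWick`) into the THREE-component leading term
`β²·Cov ≈ ¼·3·boxDirCircSqCov = (3/2)Π_D²`:  for a probability measure `μ`, a finite index type `ι` and `f, g ∈ L²(μ)`,
`cov_colourSum_pi` — `∫FG − ∫F∫G = |ι|·(∫fg dμ − ∫f dμ∫g dμ)` on `Ω^ι` with `Measure.pi (fun _ => μ)`, `F(x) = Σ_c f(x_c)`,
`G(x) = Σ_c g(x_c)`; with the marginal/factorisation lemmas `integral_pi_eval`, `integral_pi_eval_mul_eval_of_ne`,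
`integral_pi_eval_mul_eval_self` (Mathlib `integral_fintype_prod_eq_prod`).  Everything proved; no definition; standard axioms.
-/

set_option autoImplicit false

noncomputable section

open MeasureTheory Finset

namespace Summit.QuantumFields.YangMills.Theorems.WeakCouplingRates

variable {ι Ω : Type*} [Fintype ι] [DecidableEq ι] [MeasurableSpace Ω] (μ : Measure Ω) [IsProbabilityMeasure μ]

/-- Marginal of one coordinate under the product measure: `∫ f(x_c) dμ^ι = ∫ f dμ`. -/
theorem integral_pi_eval (f : Ω → ℝ) (c : ι) :
    ∫ x : ι → Ω, f (x c) ∂(Measure.pi fun _ : ι => μ) = ∫ ω, f ω ∂μ := by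
  have h := integral_fintype_prod_eq_prod (𝕜 := ℝ) (μ := fun _ : ι => μ) (fun i => if i = c then f else fun _ => 1)
  have hl : ∀ x : ι → Ω, (∏ i, (if i = c then f else fun _ => (1 : ℝ)) (x i)) = f (x c) := fun x => by
    rw [Finset.prod_eq_single c (fun i _ hi => by simp [hi]) (fun h => absurd (Finset.mem_univ c) h)]
    simp
  have hr : (∏ i, ∫ x, (if i = c then f else fun _ => (1 : ℝ)) x ∂μ) = ∫ ω, f ω ∂μ := by
    rw [Finset.prod_eq_single c (fun i _ hi => by simp [hi]) (fun h => absurd (Finset.mem_univ c) h)]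
    simp
  simp_rw [hl] at h
  rw [h, hr]

/-- Mixed second moment of two DIFFERENT coordinates factorises: `∫ f(x_c) g(x_{c'}) dμ^ι = ∫f dμ · ∫g dμ` (`c ≠ c'`). -/
theorem integral_pi_eval_mul_eval_of_ne (f g : Ω → ℝ) {c c' : ι} (hcc : c ≠ c') :
    ∫ x : ι → Ω, f (x c) * g (x c') ∂(Measure.pi fun _ : ι => μ) = (∫ ω, f ω ∂μ) * ∫ ω, g ω ∂μ := by
  set F : ι → Ω → ℝ := fun i => if i = c then f else if i = c' then g else fun _ => 1 with hF
  have h := integral_fintype_prod_eq_prod (𝕜 := ℝ) (μ := fun _ : ι => μ) F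
  have hsub : ({c, c'} : Finset ι) ⊆ Finset.univ := Finset.subset_univ _
  have hl : ∀ x : ι → Ω, (∏ i, F i (x i)) = f (x c) * g (x c') := fun x => by
    rw [← Finset.prod_subset hsub (fun i _ hi => by
      simp only [Finset.mem_insert, Finset.mem_singleton, not_or] at hi; simp [hF, hi.1, hi.2])]
    rw [Finset.prod_pair hcc]
    simp [hF, hcc.symm]
  have hr : (∏ i, ∫ x, F i x ∂μ) = (∫ ω, f ω ∂μ) * ∫ ω, g ω ∂μ := by
    rw [← Finset.prod_subset hsub (fun i _ hi => by
      simp only [Finset.mem_insert, Finset.mem_singleton, not_or] at hi; simp [hF, hi.1, hi.2])]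
    rw [Finset.prod_pair hcc]
    simp [hF, hcc.symm]
  simp_rw [hl] at h
  rw [h, hr]

/-- Second moment of ONE coordinate: `∫ f(x_c) g(x_c) dμ^ι = ∫ f g dμ`. -/
theorem integral_pi_eval_mul_eval_self (f g : Ω → ℝ) (c : ι) :
    ∫ x : ι → Ω, f (x c) * g (x c) ∂(Measure.pi fun _ : ι => μ) = ∫ ω, f ω * g ω ∂μ :=
  integral_pi_eval μ (fun ω => f ω * g ω) c

/-- **Colour additivity of the connected two-point function under a product measure**: for `F(x) = Σ_c f(x_c)`,
`G(x) = Σ_c g(x_c)` on `Ω^ι` with the product measure `μ^{⊗ι}` (`f, g ∈ L²(μ)`),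
`∫FG − ∫F∫G = |ι| · (∫fg dμ − ∫f dμ ∫g dμ)` — independent colour components do not cross-correlate.  (With `|ι| = 3`,
`f = g = ½·(circulation)²` this is the factor `¾ = ¼·3` of the `SU(2)` Gaussian surrogate in stub `stub_boxDirichletDomination`.) -/
theorem cov_colourSum_pi (f g : Ω → ℝ) (hf : MemLp f 2 μ) (hg : MemLp g 2 μ) :
    (∫ x : ι → Ω, (∑ c, f (x c)) * (∑ c, g (x c)) ∂(Measure.pi fun _ : ι => μ)) -
        (∫ x : ι → Ω, ∑ c, f (x c) ∂(Measure.pi fun _ : ι => μ)) *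
          (∫ x : ι → Ω, ∑ c, g (x c) ∂(Measure.pi fun _ : ι => μ)) =
      Fintype.card ι * ((∫ ω, f ω * g ω ∂μ) - (∫ ω, f ω ∂μ) * ∫ ω, g ω ∂μ) := by
  set π := Measure.pi fun _ : ι => μ with hπ
  haveI : IsProbabilityMeasure π := by rw [hπ]; infer_instance
  have hmp : ∀ c : ι, MeasurePreserving (fun x : ι → Ω => x c) π μ := fun c => by
    rw [hπ]; exact measurePreserving_eval _ c
  have hf2 : ∀ c : ι, MemLp (fun x : ι → Ω => f (x c)) 2 π := fun c => hf.comp_measurePreserving (hmp c)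
  have hg2 : ∀ c : ι, MemLp (fun x : ι → Ω => g (x c)) 2 π := fun c => hg.comp_measurePreserving (hmp c)
  have hfi : ∀ c : ι, Integrable (fun x : ι → Ω => f (x c)) π := fun c => (hf2 c).integrable one_le_two
  have hgi : ∀ c : ι, Integrable (fun x : ι → Ω => g (x c)) π := fun c => (hg2 c).integrable one_le_two
  have hfgi : ∀ c c' : ι, Integrable (fun x : ι → Ω => f (x c) * g (x c')) π := fun c c' => (hf2 c).integrable_mul (hg2 c')
  set A : ℝ := ∫ ω, f ω * g ω ∂μ with hA
  set B : ℝ := (∫ ω, f ω ∂μ) * ∫ ω, g ω ∂μ with hB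
  -- the mixed moments
  have hpair : ∀ c c' : ι, ∫ x : ι → Ω, f (x c) * g (x c') ∂π = if c = c' then A else B := by
    intro c c'
    by_cases h : c = c'
    · subst h; rw [if_pos rfl]; exact integral_pi_eval_mul_eval_self μ f g c
    · rw [if_neg h]; exact integral_pi_eval_mul_eval_of_ne μ f g h
  -- first moments
  have h1f : ∫ x : ι → Ω, ∑ c, f (x c) ∂π = Fintype.card ι * ∫ ω, f ω ∂μ := by
    rw [integral_finsetSum _ fun c _ => hfi c]
    simp_rw [show ∀ c : ι, ∫ x : ι → Ω, f (x c) ∂π = ∫ ω, f ω ∂μ from fun c => integral_pi_eval μ f c]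
    rw [Finset.sum_const, Finset.card_univ, nsmul_eq_mul]
  have h1g : ∫ x : ι → Ω, ∑ c, g (x c) ∂π = Fintype.card ι * ∫ ω, g ω ∂μ := by
    rw [integral_finsetSum _ fun c _ => hgi c]
    simp_rw [show ∀ c : ι, ∫ x : ι → Ω, g (x c) ∂π = ∫ ω, g ω ∂μ from fun c => integral_pi_eval μ g c]
    rw [Finset.sum_const, Finset.card_univ, nsmul_eq_mul]
  -- second moment
  have h2 : ∫ x : ι → Ω, (∑ c, f (x c)) * (∑ c, g (x c)) ∂π = Fintype.card ι * A + Fintype.card ι * (Fintype.card ι * B) - Fintype.card ι * B := by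
    simp_rw [Finset.sum_mul_sum]
    rw [integral_finsetSum _ fun c _ => integrable_finsetSum _ fun c' _ => hfgi c c']
    simp_rw [integral_finsetSum _ fun c' _ => hfgi _ c', hpair]
    have hinner : ∀ c : ι, (∑ c' : ι, if c = c' then A else B) = A + (Fintype.card ι * B - B) := fun c => by
      have : ∀ c' : ι, (if c = c' then A else B) = B + (if c = c' then A - B else 0) := fun c' => by
        split_ifs <;> ring
      simp_rw [this]
      rw [Finset.sum_add_distrib, Finset.sum_const, Finset.card_univ, nsmul_eq_mul, Finset.sum_ite_eq]
      simp
      ring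
    simp_rw [hinner]
    rw [Finset.sum_const, Finset.card_univ, nsmul_eq_mul]
    ring
  rw [h2, h1f, h1g, hB]
  ring

end Summit.QuantumFields.YangMills.Theorems.WeakCouplingRates

end
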